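import Summits.Ventures.PercRepro.SixFourResidueSize
import Summits.Ventures.PercRepro.SixFourPLCost
import Summits.Ventures.PercRepro.SixFourPLLpp

/-!
# PercRepro — C-025 at `(6,4)`: steps (1), (2) and (3) of Theorem 22.12 with the cap `g − 3` (p2, gen 8 — §21.18.9.1)

The `K`-forms of p3's `card_nclTraces_le` / `card_thirdPlanes_le` (`SixFourPLThird`), `sum_third_le` /
`sum_tyP_le` (`SixFourPLMatch`), `cost_profile_le` (`SixFourPLCost`) and `lpp_profile_le` (`SixFourPLLpp`): the
hypotheses «plane traces `≤ 7`, `10 ≤ g`» are replaced by «plane traces `≤ g − 3`, `7 ≤ g ≤ 10`».  The cap enters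
only through `n ≥ 2` (`steps_facts`) and through `cost_g ≥ 0` on the third-kind entries `{x} ∪ λ`, which needs
`|λ| + 1 ≤ g − 3` — true whenever the entry occurs (`ν_{|λ|} > 0` forces `|λ| < p ≤ g − 3`), so the list
domination `sum_tyP_le_K` asks for `F ≥ 0` only on the entries with `ν > 0`.
-/

namespace PercRepro.SixFour

open Finset ThmH

variable {α : Type*} [DecidableEq α] {M : Matroid α} [M.Finite] {G : Finset α}

namespace PL

/-- **`cost_g ≥ 0` on the third-kind entry `i`** when its `q = i + 3 ≤ g − 3` (`D₃ = ε(q − 1) ≥ C(q − 1, 3) = r₃₄`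
and `5(g − q) − 2 ≥ 13 ≥ 8`). -/
theorem cost5_xlEntry_nonneg_K (π : CProf) (g : ℕ) (i : ℕ) (hi : i ≤ 5) (hq : i + 6 ≤ g) :
    0 ≤ cost5 g (xlEntry π i) := by
  have hg' : ((i : ℤ) + 6) ≤ g := by exact_mod_cast hq
  obtain ⟨d2, d3, d4, d5, d6, d7, d8⟩ := delta_small
  obtain ⟨c2, c3, c4, c5, c6, c7, c8⟩ := ch_four_small
  unfold cost5 D3 r34 xlEntry
  interval_cases i <;>
    simp only [Nat.reduceAdd, Nat.reduceLT, ↓reduceIte, List.map_cons, List.map_nil, List.sum_cons, List.sum_nil,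
      d2, d3, d4, d5, d6, d7, d8, c2, c3, c4, c5, c6, c7, c8] <;>
    push_cast at hg' ⊢ <;> nlinarith [hg']

/-- `ν_m ≤ inc_m`. -/
theorem nu_le_incOf (π : CProf) (m : ℕ) : nu π m ≤ incOf π m := Nat.sub_le _ _

end PL

namespace PLData

variable {D : PLData M G}

/-- `#nclTraces m ≤ ν_m(π)` for `2 ≤ m ≤ 7` (`card_nclTraces_le` from `2 ≤ n` alone). -/
theorem card_nclTraces_le_K (hs : Simple M) (hG : G ⊆ gr M) (h2 : 2 ≤ D.L.card) {m : ℕ} (hm : 2 ≤ m)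
    (hm7 : m ≤ 7) : (D.nclTraces m).card ≤ PL.nu D.profile m := by
  unfold PL.nu
  rw [incOf_profile hm hm7, show D.profile.sizes = D.sizes from rfl, sizes_count]
  exact Nat.le_sub_of_add_le (card_nclTraces_add_le hs hG h2 hm)

/-- The planes of the third kind with `|P ∩ ρ| = m` number at most `n·ν_m` (`card_thirdPlanes_le` from `2 ≤ n`). -/
theorem card_thirdPlanes_le_K (hs : Simple M) (hG : G ⊆ gr M) (h2 : 2 ≤ D.L.card) {m : ℕ} (hm : 2 ≤ m)
    (hm7 : m ≤ 7) : (D.thirdPlanes m).card ≤ D.L.card * PL.nu D.profile m := by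
  have hsub : D.thirdPlanes m ⊆
      (D.L ×ˢ D.nclTraces m).image (fun q : α × Finset α => clF M (insert q.1 q.2)) := by
    intro P hP
    obtain ⟨hP3, hne, hnPi, hcard⟩ := Finset.mem_filter.1 hP
    obtain ⟨x, hx, htr, hr2, hncl⟩ := third_spec hs hG h2 hP3 hne hnPi
    have hP' := (mem_planesR3.1 hP3).1
    rw [Finset.mem_image]
    refine ⟨(x, P ∩ D.ρ), ?_, ?_⟩
    · rw [Finset.mem_product]
      refine ⟨hx, ?_⟩
      unfold nclTraces
      rw [Finset.mem_filter, Finset.mem_image]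
      refine ⟨⟨clF M (P ∩ D.ρ), ?_, clF_inter_ρ_eq hG hP'⟩, hcard, hncl⟩
      exact (clF_mem_lines (Finset.inter_subset_right.trans (D.ρ_subset.trans hG)) hr2).1
    · dsimp only
      rw [← htr]
      exact (plane_eq_clF_trace hP' (mem_planesR3.1 hP3).2).symm
  calc (D.thirdPlanes m).card ≤ ((D.L ×ˢ D.nclTraces m).image
        (fun q : α × Finset α => clF M (insert q.1 q.2))).card := Finset.card_le_card hsub
    _ ≤ (D.L ×ˢ D.nclTraces m).card := Finset.card_image_le
    _ = D.L.card * (D.nclTraces m).card := Finset.card_product _ _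
    _ ≤ D.L.card * PL.nu D.profile m := Nat.mul_le_mul_left _ (card_nclTraces_le_K hs hG h2 hm hm7)

/-- The third-kind sum is at most `Σ_i n·ν_{i+2}·F(xlEntry i)` for `F ≥ 0` on the entries with `ν > 0`
(`sum_third_le` with `p ≤ 7` in place of the cap, `F ≥ 0` asked only where it matters). -/
theorem sum_third_le_K (hs : Simple M) (hG : G ⊆ gr M) (h2 : 2 ≤ D.L.card) (hp7 : D.ρ.card ≤ 7)
    (F : PL.Pl → ℚ) (hF : ∀ i < 6, 0 < PL.nu D.profile (i + 2) → 0 ≤ F (PL.ty (PL.xlEntry D.profile i))) :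
    ∑ P ∈ (planesR3 M G).filter (fun P => P ≠ D.P₀ ∧ P ∉ D.piPlanes), F (tyP M G P) ≤
      ∑ i ∈ Finset.range 6, ((D.L.card * PL.nu D.profile (i + 2) : ℕ) : ℚ) * F (PL.ty (PL.xlEntry D.profile i)) := by
  set T := (planesR3 M G).filter (fun P => P ≠ D.P₀ ∧ P ∉ D.piPlanes) with hT
  have hbounds : ∀ P ∈ T, 2 ≤ (P ∩ D.ρ).card ∧ (P ∩ D.ρ).card ≤ 7 := by
    intro P hP
    rw [hT, Finset.mem_filter] at hP
    obtain ⟨hP3, hne, hnPi⟩ := hP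
    obtain ⟨x, hx, htr, hr2, -⟩ := third_spec hs hG h2 hP3 hne hnPi
    refine ⟨card_ge_two_of_rank_two hr2, ?_⟩
    exact (Finset.card_le_card Finset.inter_subset_right).trans hp7
  rw [← Finset.sum_fiberwise_of_maps_to (g := fun P : Finset α => (P ∩ D.ρ).card - 2) (t := Finset.range 6)
    (fun P hP => by rw [Finset.mem_range]; have := hbounds P hP; omega)]
  refine Finset.sum_le_sum (fun i hi => ?_)
  rw [Finset.mem_range] at hi
  have hconst : ∀ P ∈ T.filter (fun P => (P ∩ D.ρ).card - 2 = i),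
      F (tyP M G P) = F (PL.ty (PL.xlEntry D.profile i)) := by
    intro P hP
    simp only [Finset.mem_filter, hT] at hP
    obtain ⟨⟨hP3, hne, hnPi⟩, hi'⟩ := hP
    obtain ⟨x, hx, htr, hr2, -⟩ := third_spec hs hG h2 hP3 hne hnPi
    rw [tyP_third hs hG h2 hx htr hr2, hi']
  have hsub : T.filter (fun P => (P ∩ D.ρ).card - 2 = i) ⊆ D.thirdPlanes (i + 2) := by
    intro P hP
    simp only [Finset.mem_filter, hT] at hP
    obtain ⟨⟨hP3, hne, hnPi⟩, hi'⟩ := hP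
    obtain ⟨x, hx, htr, hr2, -⟩ := third_spec hs hG h2 hP3 hne hnPi
    have h2c := card_ge_two_of_rank_two hr2
    exact Finset.mem_filter.2 ⟨hP3, hne, hnPi, by omega⟩
  rw [Finset.sum_congr rfl hconst, Finset.sum_const, nsmul_eq_mul]
  have hcard : (T.filter (fun P => (P ∩ D.ρ).card - 2 = i)).card ≤ D.L.card * PL.nu D.profile (i + 2) :=
    (Finset.card_le_card hsub).trans (card_thirdPlanes_le_K hs hG h2 (by omega) (by omega))
  by_cases hnu : 0 < PL.nu D.profile (i + 2)
  · exact mul_le_mul_of_nonneg_right (by exact_mod_cast hcard) (hF i hi hnu)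
  · have h0 : PL.nu D.profile (i + 2) = 0 := by omega
    rw [h0, Nat.mul_zero] at hcard ⊢
    have hc0 : (T.filter (fun P => (P ∩ D.ρ).card - 2 = i)).card = 0 := by omega
    simp [hc0]

/-- **The list dominates the planes (22.12.4)** for `F ≥ 0` on the third-kind entries with `ν > 0`
(`sum_tyP_le` with `2 ≤ n`, `p ≤ 7`). -/
theorem sum_tyP_le_K (hs : Simple M) (hG : G ⊆ gr M) (h2 : 2 ≤ D.L.card) (hp7 : D.ρ.card ≤ 7)
    (F : PL.Pl → ℚ) (hF : ∀ i < 6, 0 < PL.nu D.profile (i + 2) → 0 ≤ F (PL.ty (PL.xlEntry D.profile i))) :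
    ∑ P ∈ planesR3 M G, F (tyP M G P) ≤
      ((PL.planes D.profile).map fun Q => (Q.mult : ℚ) * F (PL.ty Q)).sum := by
  rw [PL.planes_eq, List.map_append, List.map_append, List.sum_append, List.sum_append, List.map_map,
    List.map_map, List.map_cons, List.map_nil, List.sum_cons, List.sum_nil, add_zero,
    show D.profile.sizes = D.sizes from rfl, sum_planesR3_eq hs hG h2, tyP_P₀, sum_piPlanes_eq hs hG h2 F]
  have hmult : (D.sizes.map ((fun Q : PL.Pl => (Q.mult : ℚ) * F (PL.ty Q)) ∘ PL.piEntry D.profile)).sum =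
      (D.sizes.map fun s => F (PL.ty (PL.piEntry D.profile s))).sum := by
    refine congrArg List.sum (List.map_congr_left (fun s _ => ?_))
    simp only [Function.comp_apply, PL.piEntry_mult, Nat.cast_one, one_mul]
  have hxl : ((List.range 6).map ((fun Q : PL.Pl => (Q.mult : ℚ) * F (PL.ty Q)) ∘ PL.xlEntry D.profile)).sum =
      ∑ i ∈ Finset.range 6, ((D.L.card * PL.nu D.profile (i + 2) : ℕ) : ℚ) * F (PL.ty (PL.xlEntry D.profile i)) := by
    rw [list_sum_range']
    refine Finset.sum_congr rfl (fun i _ => ?_)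
    simp only [Function.comp_apply, PL.xlEntry_mult]
    rfl
  rw [hmult, hxl, PL.rhoEntry_mult, Nat.cast_one, one_mul]
  have := sum_third_le_K hs hG h2 hp7 F hF
  linarith

/-- A third-kind entry with `ν_{i+2} > 0` has `i + 6 ≤ g` when the plane traces are `≤ g − 3`: a non-class line
of `ρ` with `i + 2` points exists, so `i + 2 < p ≤ g − 3`. -/
theorem six_add_le_of_nu_pos (hpl : ∀ P ∈ planes M, (P ∩ G).card + 3 ≤ G.card) {i : ℕ} (hi : i < 6)
    (hnu : 0 < PL.nu D.profile (i + 2)) : i + 6 ≤ G.card := by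
  have hinc : 0 < PL.incOf D.profile (i + 2) := lt_of_lt_of_le hnu (PL.nu_le_incOf _ _)
  rw [incOf_profile (by omega) (by omega)] at hinc
  have hlt : i + 2 < D.ρ.card := by
    by_contra h
    push Not at h
    rw [inc_eq_zero_of_card_le (eRk_ρ (D := D)) h] at hinc
    exact lt_irrefl _ hinc
  have := hpl _ D.plane
  unfold ρ at hlt
  omega

/-- **Step (1) with the cap `g − 3`** (`cost_profile_le` of `SixFourPLCost`): `5·Σ_{P ∈ planes M} cost_g(P) ≤
cost5sum(π)` for `7 ≤ g ≤ 10` and plane traces `≤ g − 3`. -/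
theorem cost_profile_le_K (hs : Simple M) (hG : G ⊆ gr M) (hpl : ∀ P ∈ planes M, (P ∩ G).card + 3 ≤ G.card)
    (hg : 7 ≤ G.card) (hg10 : G.card ≤ 10) : 5 * ∑ P ∈ planes M, cost M G P ≤ (PL.cost5sum D.profile : ℚ) := by
  obtain ⟨h2, -, hne, hp7, hpl7, hsz⟩ := steps_facts (D := D) hs hG hpl hg hg10
  have h1 : 5 * ∑ P ∈ planes M, cost M G P ≤ 5 * ∑ P ∈ planesR3 M G, cost M G P :=
    mul_le_mul_of_nonneg_left (sum_cost_le G) (by norm_num)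
  have h2' : 5 * ∑ P ∈ planesR3 M G, cost M G P = ∑ P ∈ planesR3 M G, (PL.cost5 G.card (tyP M G P) : ℚ) := by
    rw [Finset.mul_sum]
    refine Finset.sum_congr rfl (fun P hP => ?_)
    obtain ⟨hP, hr3⟩ := mem_planesR3.1 hP
    rw [cost5_tyP hs hG (hpl7 P hP) hr3]
  have h3 : ∑ P ∈ planesR3 M G, (PL.cost5 G.card (tyP M G P) : ℚ) ≤
      ((PL.planes D.profile).map fun Q => (Q.mult : ℚ) * (PL.cost5 G.card (PL.ty Q) : ℚ)).sum :=
    sum_tyP_le_K hs hG h2 hp7 (fun Q => (PL.cost5 G.card Q : ℚ)) (fun i hi hnu => by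
      rw [PL.cost5_ty _ _ (PL.Small_xlEntry _ i (by omega))]
      exact_mod_cast PL.cost5_xlEntry_nonneg_K D.profile G.card i (by omega) (six_add_le_of_nu_pos hpl hi hnu))
  have h4 : ((PL.planes D.profile).map fun Q => (Q.mult : ℚ) * (PL.cost5 G.card (PL.ty Q) : ℚ)).sum =
      (PL.cost5sum D.profile : ℚ) := by
    unfold PL.cost5sum
    rw [g_profile_eq]
    push_cast
    rw [List.map_map]
    refine congrArg List.sum (List.map_congr_left (fun Q hQ => ?_))
    simp only [Function.comp_apply, Int.cast_mul, Int.cast_natCast]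
    rw [PL.cost5_ty _ _ (PL.Small_of_mem_planes D.profile
      (by rw [e_profile_eq hs hG h2]; show D.L.card + (D.ellF ∩ D.ρ).card ≤ 7; omega)
      (fun s hs' => by have := hsz s hs'; omega) hQ)]
  linarith [h1, h2', h3, h4]

/-- **Step (3) with the cap `g − 3`** (`lpp_profile_le` of `SixFourPLLpp`): `lpp(π) ≤ lpp(G)` for `7 ≤ g ≤ 10`
and plane traces `≤ g − 3`. -/
theorem lpp_profile_le_K (hs : Simple M) (hG : G ⊆ gr M) (hpl : ∀ P ∈ planes M, (P ∩ G).card + 3 ≤ G.card)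
    (hg : 7 ≤ G.card) (hg10 : G.card ≤ 10) : (PL.lpp D.profile : ℚ) ≤ (lpp M G : ℚ) := by
  obtain ⟨h2, hn3, hne, hp7, hpl7, -⟩ := steps_facts (D := D) hs hG hpl hg hg10
  -- the line side
  have hline : (PL.lineSum D.profile : ℚ) ≤
      ∑ L ∈ lines M, ((eps (L ∩ G).card : ℚ) * ((G.card - (L ∩ G).card).choose 2 : ℚ)) := by
    have key := profile_line_sum_le hs hG h2 hne hn3 hp7
      (fun m => (eps m : ℚ) * ((G.card - m).choose 2 : ℚ)) (fun m => by positivity)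
      (fun m hm => by rw [eps_le_two hm]; simp)
    have e0 : eps 0 = 0 := by decide
    have e1 : eps 1 = 0 := by decide
    have e2 : eps 2 = 0 := by decide
    simp only [Finset.sum_range_succ, Finset.sum_range_zero, e0, e1, e2, Nat.cast_zero, zero_mul, mul_zero,
      zero_add] at key
    unfold PL.lineSum
    rw [g_profile_eq, list_sum_range']
    simp only [Finset.sum_range_succ, Finset.sum_range_zero, PLeps_eq, PLch_eq_choose]
    push_cast
    linarith
  -- the plane side
  have hplane : ∑ P ∈ planesR3 M G, (lppCredit M G P : ℚ) ≤
      (((PL.planes D.profile).map fun Q => (Q.mult : ℤ) * PL.credit Q).sum : ℚ) := by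
    have h1 : ∑ P ∈ planesR3 M G, (lppCredit M G P : ℚ) = ∑ P ∈ planesR3 M G, ((PL.credit (tyP M G P) : ℤ) : ℚ) := by
      refine Finset.sum_congr rfl (fun P hP => ?_)
      obtain ⟨hP, hr3⟩ := mem_planesR3.1 hP
      rw [credit_tyP (hpl7 P hP) hr3]
      push_cast
      rfl
    have h3 : ∑ P ∈ planesR3 M G, ((PL.credit (tyP M G P) : ℤ) : ℚ) ≤
        ((PL.planes D.profile).map fun Q => (Q.mult : ℚ) * ((PL.credit (PL.ty Q) : ℤ) : ℚ)).sum :=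
      sum_tyP_le_K hs hG h2 hp7 (fun Q => ((PL.credit Q : ℤ) : ℚ)) (fun i _ _ => by
        exact_mod_cast PL.credit_nonneg _)
    have h4 : ((PL.planes D.profile).map fun Q => (Q.mult : ℚ) * ((PL.credit (PL.ty Q) : ℤ) : ℚ)).sum =
        (((PL.planes D.profile).map fun Q => (Q.mult : ℤ) * PL.credit Q).sum : ℚ) := by
      push_cast
      rw [List.map_map]
      refine congrArg List.sum (List.map_congr_left (fun Q _ => ?_))
      simp only [Function.comp_apply, Int.cast_mul, Int.cast_natCast, PL.credit_ty]
    rw [h1]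
    linarith [h3, h4]
  -- the identity 22.2 as two inequalities (`lpp_ge`, `sum_eps_choose_le`), with `S = planesR3`
  have F9 : ∑ L ∈ lines M, ((eps (L ∩ G).card : ℚ) * ((crossPairs M G L).card : ℚ)) ≤ (lpp M G : ℚ) := by
    have := lpp_ge hs hG
    have h' : ∑ L ∈ lines M, ((eps (L ∩ G).card : ℚ) * ((crossPairs M G L).card : ℚ)) =
        ((∑ L ∈ lines M, eps (L ∩ G).card * (crossPairs M G L).card : ℕ) : ℚ) := by push_cast; rfl
    rw [h']
    exact_mod_cast this
  have F10 : ∑ L ∈ lines M, ((eps (L ∩ G).card : ℚ) * ((G.card - (L ∩ G).card).choose 2 : ℚ)) ≤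
      ∑ L ∈ lines M, ((eps (L ∩ G).card : ℚ) * ((crossPairs M G L).card : ℚ)) +
        ∑ P ∈ planesR3 M G, (lppCredit M G P : ℚ) := by
    have := sum_eps_choose_le (M := M) (G := G) hs hG
    have h1 : ∑ L ∈ lines M, ((eps (L ∩ G).card : ℚ) * ((G.card - (L ∩ G).card).choose 2 : ℚ)) =
        ((∑ L ∈ lines M, eps (L ∩ G).card * (G.card - (L ∩ G).card).choose 2 : ℕ) : ℚ) := by push_cast; rfl
    have h2' : ∑ L ∈ lines M, ((eps (L ∩ G).card : ℚ) * ((crossPairs M G L).card : ℚ)) =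
        ((∑ L ∈ lines M, eps (L ∩ G).card * (crossPairs M G L).card : ℕ) : ℚ) := by push_cast; rfl
    have h3 : ∑ P ∈ planesR3 M G, (lppCredit M G P : ℚ) = ((∑ P ∈ planesR3 M G, lppCredit M G P : ℕ) : ℚ) := by
      push_cast; rfl
    rw [h1, h2', h3, ← Nat.cast_add]
    exact_mod_cast this
  rw [PL.lpp_eq, Int.cast_sub]
  linarith [hline, hplane, F9, F10]

/-- **Step (2)** (`bonus5sum_profile_le` of `SixFourPLBonus` — no cap; its hypotheses hold by `steps_facts`):
`bonus5sum(π) ≤ 5·Σ_{L ∈ lines M} bonus(|L ∩ G|)`. -/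
theorem bonus5sum_profile_le_K (hs : Simple M) (hG : G ⊆ gr M)
    (hpl : ∀ P ∈ planes M, (P ∩ G).card + 3 ≤ G.card) (hg : 7 ≤ G.card) (hg10 : G.card ≤ 10) :
    (PL.bonus5sum D.profile : ℚ) ≤ 5 * ∑ L ∈ lines M, bonus (L ∩ G).card := by
  obtain ⟨h2, hn3, hne, hp7, -, -⟩ := steps_facts (D := D) hs hG hpl hg hg10
  exact bonus5sum_profile_le hs hG h2 hne hn3 hp7

end PLData

end PercRepro.SixFour
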